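import Summits.ABC.IUTFork.Cor312TwoPlaceSetting
import Summits.ABC.IUTFork.Repair.CandMochizuki40
import HarnessLib

/-!
# IUT REPAIR branch (rung LADDER-ABC:A2.RP), row RP-M40 (seat abc-iut-rp-m4) — companion: the author's (EssGlIq) consistency claim
# `H'` («Cor. 3.12 holds, yet not as a sum of local inequalities») READ OFF the two-place bed (engine request E4)

Record file of the abc-iut cell's REPAIR branch (seat abc-iut-rp-m4; lead abc-iut-rp-plan, GO 2026-08-26T08:18:35Z (6)). TAKES NO SIDE on
[IUTchIII] Cor. 3.12 or on any author; candidates are hypotheses (`Repair/CandMochizuki40`, p431550); typed ≠ proved; PROOF-ONLY file (no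
definition). `CandMochizuki40` proved: on every ONE-PLACE index `Placewise ⟺ Statement`, so `H' := Statement ∧ ¬ Placewise` — S. Mochizuki's
[Rpt2024-03] (EssGlIq) `paper:url-b58939b9dc8f` p. 7 l. 41–44 «any essentially global inequality — i.e., such as … [IUTchIII], Corollary 3.12
— can never be obtained … as a result of summing up local inequalities at each prime», typed as a consistency claim — has NO one-place
model (`onePlace_collapse`). The two-place bed `Cor312TwoPlaceSetting` (p433610/p433752: two places, honest q, Θ-images with log-shell
inflation `d = (0, 3)`, typed Thm. 3.11, bridge hypotheses, `|log(q)| > 0`) now gives: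
* `localStatementAt_two_iff` — the LOCAL PORTION at the place `v` ⟺ `3 ≤ 2·d(v)`; `placewise_two_iff`;
* `H'_two` — **`H'` HOLDS at the two-place setting of record** (Statement TRUE globally, local portion FALSE at the deep place `0`):
  T-c(RP-M40b) = SAT[two places; ρ/(Ind3) locus at the place `1`], and `H_two`;
* `H'_two_profile` — there, moreover, the (xi-f) Licence, Reading R3 and — for every pin-respecting region reading — the residual S all FAIL
  (`CandMochizuki40.essGl_situation` made concrete): the typed Corollary satisfied WITHOUT any placewise supplier;
* `essGl_expressible` — the census sentence in the kernel: «¬H′ on every one-place setting ∧ H′ at a two-place setting».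
Nothing asserted about print; standard axioms only. [claim: Mochizuki2012, status: disputed]
-/

noncomputable section

open Set

namespace Summit.ABC.IUTFork.Repair.CandMochizuki40

open Thm311 Cor312 Cor312Vol Cor312Vol.TwoPlace Literature.IUT.LogThetaLattice

variable (p : ℕ) [hp : Fact p.Prime] (c : ℝ) (d : twoIndex.VQ → ℕ)

/-- **The local portion at the place `v` of the two-place setting IS `3 ≤ 2·d(v)`** (`c > 0`; every hull term is finite there).
[folklore] -/
theorem localStatementAt_two_iff (hc : 0 < c) (vQ : twoIndex.VQ) : LocalStatementAt (twoSetting p c d) vQ ↔ 3 ≤ 2 * d vQ := by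
  unfold LocalStatementAt localNegLogQ localNegLogTheta
  rw [← two_local_iff p c d hc vQ]
  exact ⟨fun h => h.2, fun h => ⟨fun i => (two_thetaFinite p c d).1 i vQ, h⟩⟩

/-- `Placewise` at the two-place setting ⟺ `3 ≤ 2·d(v)` at BOTH places. [folklore] -/
theorem placewise_two_iff (hc : 0 < c) : Placewise (twoSetting p c d) ↔ ∀ vQ : twoIndex.VQ, 3 ≤ 2 * d vQ :=
  forall_congr' fun vQ => localStatementAt_two_iff p c d hc vQ

/-- At the profile of record `depth = (0, 3)` the placewise version FAILS (place `0`). [folklore] -/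
theorem not_placewise_depth (hc : 0 < c) : ¬ Placewise (twoSetting p c depth) := fun h => by
  have h0 := (placewise_two_iff p c depth hc).1 h 0
  rw [depth_val.1] at h0
  exact absurd h0 (by decide)

/-- `H` (the (EssGlIq) situation) holds at the two-place setting of record. [folklore] -/
theorem H_two (hc : 0 < c) : H (twoSetting p c depth) := not_placewise_depth p c hc

/-- **`H'` HOLDS at the two-place setting of record**: the typed Statement is TRUE (globally, `−2c ≤ −2c`) and the placewise version is
FALSE — the author's «essentially global» situation has a model over the frozen interface as soon as there are two places. T-c of RP-M40b:
SAT[two places]. [claim: Mochizuki2012, status: disputed] -/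
theorem H'_two (hc : 0 < c) : H' (twoSetting p c depth) := ⟨two_statement p c hc, not_placewise_depth p c hc⟩

/-- **The profile at the witness**: `H'`, and with it NO packetwise target — the (xi-f) Licence fails, Reading R3 fails, and for every
pin-respecting region reading `(ρ, qK)` the residual S fails (here by the bed's own cells; equally by `essGl_situation`). [folklore] -/
theorem H'_two_profile (hc : 0 < c) :
    H' (twoSetting p c depth) ∧ ¬ Thm311ToCor312.Licence (twoSetting p c depth) ∧
      (¬ ∀ (i : Fin twoIndex.lstar) (vQ : twoIndex.VQ),
        (twoSetting p c depth).qRegion (Setting.labelSucc i) vQ ∈ (twoSetting p c depth).possibleImages (Setting.labelSucc i) vQ) ∧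
      ∀ ρ qK, PinnedRegions (twoFull p c).toLatticeSituation (twoSetting p c depth) ρ qK →
        ¬ PilotKummerIndRelated (twoFull p c).toLatticeSituation (twoSetting p c depth) ρ qK :=
  ⟨H'_two p c hc, two_not_licence p c, two_not_reading3 p c, fun ρ qK hpin => two_not_S p c ρ qK hpin⟩

omit hp in
/-- **T-c for `H'` (`H'_satisfiable`)**: typed Thm. 3.11 ∧ `BridgeHyps` ∧ `|log(q)| > 0` ∧ `H'` (∧ Statement ∧ ¬ Licence) jointly satisfiable —
at the two-place bed with `p = 2`, `c = log 2`, `d = (0, 3)`. (Pins: part III of the bed; the S-cell above already covers EVERY pin-respecting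
reading.) [claim: Mochizuki2012, status: disputed] -/
theorem H'_satisfiable :
    ∃ (T : ThetaIndex) (F : FullSituation T) (P : Cor312.Setting F.toLatticeSituation.toSituation),
      F.Statement ∧ BridgeHyps P ∧ P.AbsLogQPos ∧ H' P ∧ P.Statement ∧ ¬ Thm311ToCor312.Licence P ∧
        ∀ ρ qK, PinnedRegions F.toLatticeSituation P ρ qK → ¬ PilotKummerIndRelated F.toLatticeSituation P ρ qK := by
  haveI : Fact (Nat.Prime 2) := ⟨Nat.prime_two⟩
  have hc : 0 < Real.log 2 := Real.log_pos (by norm_num)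
  exact ⟨twoIndex, twoFull 2 (Real.log 2), twoSetting 2 (Real.log 2) depth, twoFull_statement 2 _,
    two_bridgeHyps 2 _ depth hc.le, two_absLogQPos 2 _ depth hc, H'_two 2 _ hc, two_statement 2 _ hc, two_not_licence 2 _,
    fun ρ qK hpin => two_not_S 2 _ ρ qK hpin⟩

omit hp in
/-- **THE CENSUS SENTENCE IN THE KERNEL — (EssGlIq) is EXPRESSIBLE and needs two places**: the author's consistency claim `H'` fails at
EVERY Cor.-3.12 setting over EVERY situation on the cell's one-place index (all models of record), and HOLDS at a two-place setting carrying
the typed Theorem 3.11, the bridge hypotheses and `|log(q)| > 0`. Neutral record; no judgement on print. [claim: Mochizuki2012, status: disputed] -/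
theorem essGl_expressible :
    (∀ (S : Situation Cor312.Checks.toyIndex) (P : Cor312.Setting S), ¬ H' P) ∧
      ∃ (F : FullSituation twoIndex) (P : Cor312.Setting F.toLatticeSituation.toSituation),
        F.Statement ∧ BridgeHyps P ∧ P.AbsLogQPos ∧ H' P := by
  haveI : Fact (Nat.Prime 2) := ⟨Nat.prime_two⟩
  have hc : 0 < Real.log 2 := Real.log_pos (by norm_num)
  exact ⟨fun S P => (onePlace_collapse S P).2, twoFull 2 (Real.log 2), twoSetting 2 (Real.log 2) depth, twoFull_statement 2 _,
    two_bridgeHyps 2 _ depth hc.le, two_absLogQPos 2 _ depth hc, H'_two 2 _ hc⟩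

end Summit.ABC.IUTFork.Repair.CandMochizuki40

end
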